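/-
Copyright (c) 2026 the pub-hodgecm-mathlib formalisation cell (harness21).  Prover seat hodgecm-mathlib-K2E5-p17 (g6), HCML Track B «K2-LIT» ∕ h413
(`stmt-HodgeConjecture-24833`), line «SC′-IRR-lev» (leaf (S-C′-irr) `sig_K2E3GL3TwoBlockInducedIrreducible`; lead K2E3-p24 (g2), dealer K2E3-plan (g4)),
brick JM-B (file 2c, the head): the CROSS Jacquet module `r_{P₍₁,₂₎}(Ind_{P₍₂,₁₎}^{GL₃} σ')` is irreducible for a `GL₂`-cuspidal block.  2026-09-04.
-/
import Summits.HodgeConjecture.HodgeConjecture.Theorems.K2E3GL3CuspidalBlockClosedCell    -- ★ JM-B file 2b (this seat): the closed orbit is invisible (brings ★ file 2a, ★ file 1, ★ K0)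
import Summits.HodgeConjecture.HodgeConjecture.Theorems.K2E3GL3CuspidalBlockRestriction   -- ★ BLK p859461 (K2E3-p21 (g6)): `permGL_rev_conj_blockDiagonalGL_mem` (the letter of `hirr`), `forall_submodule_eq_bot_or_top_of_leviStable_rev`
import HarnessLib

/-!
# K2_E3 road (h413), line «SC′-IRR-lev», brick JM-B (head) — `r_{P₍₁,₂₎}(Ind_{P₍₂,₁₎}^{GL₃(F)} σ')` is IRREDUCIBLE when the `GL₂`-block of `σ'` is cuspidal and `σ'|_{M}` is irreducible

Cell `pub/hodgecm-mathlib` (D-0151), Track B, seat K2E5-p17 (g6) (hand JM-B of line «SC′-IRR-lev»; lead K2E3-p24 (g2) FILE PLAN v2 10:20:22Z, SPEC 10:27:03Z: «final head in `jacquetGL`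
currency: `isIrreducible_jacquetGL_oneTwo (σ') (hσ') [Nontrivial W] (hW₀₁) (hirr) : (jacquetGL F ![0,1,1] (smoothIndRep P σ')).IsIrreducible`»).  `--supports stmt-HodgeConjecture-24833 --as helper`;
THEOREMS ONLY (no definition ∕ instance ∕ notation ∕ named fact ∕ `sorry`); never imports `Cruxes/…/Lines`.  COUNT-NEUTRAL.

THE MATHEMATICS ([BernsteinZelevinsky1977, Geometrical Lemma 2.12 and Thm. 5.2 for the pair `(P₍₂,₁₎, P₍₁,₂₎)` of `GL₃`]; [Zelevinsky1980, §1.1–1.2]; [Casselman1995, §6.3]).  `F` a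
non-archimedean local field, `c₀ = ![0,0,1]`, `c₁ = ![0,1,1]`, `P = standardParabolicGL F c₀ = P₍₂,₁₎`, `N' = oppositeCellRadical c₀ = unipotentRadicalGL F c₁ = U_{P₍₁,₂₎}` (★ K0),
`M' = standardLeviGL F c₁`, `w₀ = permGL Fin.revPerm` (so `w₀ M' w₀⁻¹ = M ≤ P`, `permGL_rev_conj_mem_standardParabolicGL_of_mem_standardLeviGL`), `σ'` a smooth representation of `P` on `W`,
`I = Ind_P^{GL₃} σ'` (★ `smoothIndRep`), `r_{Q'}(I) = jacquetGL F c₁ I` — the (unnormalised) Jacquet module along `U_{P₍₁,₂₎}`, a representation of the block Levi `Π a, GL {i ∕∕ c₁ i = a} F`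
acting through `blockDiagonalGL` (★ `jacquetGL_mk`), on the carrier `(restrictUnipotentGL F c₁ I).Coinvariants` whose classes we write `[y]_{Q'}`; `Φ_{K₀,w} = cellSection σ' _ hσ' K₀ _ _ w`.

* §1 BRIDGE `coinvariantsKer_restrictUnipotentGL_oneTwo_eq` : the coinvariant kernels of `restrictUnipotentGL F c₁ I` and of `I ∘ N'.subtype` coincide (same generators, ★ K0
  `oppositeCellRadical_eq_unipotentRadicalGL_oneTwo`); `exists_coinvariants_linearEquiv` : `[y]_{Q'} ↦ [y]` is a linear equivalence (Mathlib `Submodule.quotEquivOfEq`).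
* §2 THE FOUR §-LEMMAS OF THE LEAD'S PLAN in `[·]_{Q'}` currency: (closed) **`exists_mem_vanishingOn_mk_eq (hσ') (hW₀₁) (f) : ∃ f₀ ∈ I_open, [f]_{Q'} = [f₀]_{Q'}`** (★ file 2b); (open)
  **`exists_eq_mk_cellSection (K₀) (f₀ ∈ I_open) : ∃ w, [f₀]_{Q'} = [Φ_{K₀,w}]_{Q'}`** and `exists_eq_mk_cellSection_of_span : ∀ x : r_{Q'}(I), ∃ w, x = [Φ_{K₀,w}]_{Q'}` (★ file 1);
  **`mk_cellSection_levi' (hm' : m' ∈ M') : ∃ q : ℚ, 0 < q ∧ ∀ w, [I m' Φ_{K₀,w}]_{Q'} = q • [Φ_{K₀, σ'(w₀ m' w₀⁻¹) w}]_{Q'}`** (★ file 1); **`mk_cellSection_ne_zero (hw : w ≠ 0) : [Φ_{K₀,w}]_{Q'} ≠ 0`** (★ file 1).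
* §3 **`isIrreducible_jacquetGL_oneTwo`** — the SPEC head: if `W ≠ 0`, `W(x₀₁) = W` (`hW₀₁`, = ★ BLK `mem_span_twist_transvection_zero_one_sub` for `σ' = σ ∘ proj ⊗ δ^{1∕2}`, `σ` cuspidal on
  the `GL₂` block) and `W` has no proper non-zero submodule stable under `σ' ∘ Ad(w₀)|_{M'}` (`hirr`, = ★ BLK `forall_submodule_eq_bot_or_top_of_leviStable`), then `r_{Q'}(I)` is irreducible:
  `w ↦ [Φ_{K₀,w}]_{Q'}` is a linear surjection `W ↠ r_{Q'}(I)` (§2), the preimage of a subrepresentation is `Ad(w₀) M'`-stable (the Levi acts on standard classes through `σ' ∘ Ad(w₀)` up to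
  positive rationals), hence `⊥` or `⊤`, and `r_{Q'}(I) ≠ 0` by the non-vanishing.  So `r_{P₍₁,₂₎}(Ind_{P₍₂,₁₎} σ') ≅ w₀ ∘ σ'|_M` (as far as the line needs it: irreducible and non-zero) —
  the cross term of the Geometrical Lemma, the closed orbit contributing nothing.

HONEST LABEL: HC_CM is proved only modulo the 7 printed citations (2 remaining named inputs: hLiu418 = stmt-HodgeConjecture-24832, h413 = stmt-HodgeConjecture-24833) until rung 0
closes; count-neutral helper (kernel lane).  The leaf (S-C′-irr) itself is assembled by the lead (ASM `K2E3GL3TwoBlockInducedIrreducible`) from JM-A, JM-B (this file), BLK, T1, LEV-3, DEG.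

## Mathlib ∕ tree search
★ file 1 `K2E3OpenCellJacquetClasses` (`exists_eq_mk_cellSection`, `exists_mk_smoothIndRep_cellSection_eq_smul`, `mk_cellSection_ne_zero`, `cellSectionₗ`), ★ file 2b `K2E3GL3CuspidalBlockClosedCell`
(`exists_mem_vanishingOn_mk_comp_eq_of_span`), ★ K0 (`oppositeCellRadical_eq_unipotentRadicalGL_oneTwo`, `reversedParabolic_eq_oneTwo`, `mem_standardParabolicGL_iff_entry`, `monotone_twoOne`),
★ `ParabolicGL` (`restrictUnipotentGL`, `jacquetGL`, `jacquetGL_mk`, `blockDiagonalGL`, `leviEmbedding_apply`, `standardLeviGL_le`), ★ `GLnTwoBlockLeviStructure` (`mem_standardLeviGL_iff`),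
★ `InducedWhittakerVanishing` (`coe_permGL_mul_mul_inv`), Mathlib `Representation.IsIrreducible = IsSimpleOrder (Subrepresentation _)`, `Subrepresentation.toSubmodule_injective`,
`Submodule.quotEquivOfEq`, `Representation.Coinvariants.mk_surjective`.  Dedup: `rg "CuspidalBlockJacquetCross"` — none; `rg "isIrreducible_jacquetGL"` — none.

## References
* [BernsteinZelevinsky1977] I. N. Bernstein, A. V. Zelevinsky, *Induced representations of reductive 𝔭-adic groups I*, Ann. Sci. ÉNS 10 (1977), Lemma 2.12, Thm. 5.2.
* [Zelevinsky1980] A. V. Zelevinsky, *Induced representations of reductive 𝔭-adic groups II*, Ann. Sci. ÉNS 13 (1980), §1.1–1.2.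
* [Casselman1995] W. Casselman, *Introduction to the theory of admissible representations of 𝔭-adic reductive groups* (draft 1995), §6.3.
-/

set_option autoImplicit false
set_option linter.dupNamespace false   -- `Summit.HodgeConjecture.HodgeConjecture.…` (D-0017 nested layout; lakefile exemption for Summits)

noncomputable section

open scoped BigOperators Pointwise
open Matrix OrderDual Topology
open Literature.NumberTheory.Automorphic
open Summit.HodgeConjecture.HodgeConjecture.Cruxes.H413.K2E3GL3MaximalParabolicRelabel
open Summit.HodgeConjecture.HodgeConjecture.Cruxes.H413.K2E3GL3CuspidalBlockClosedCellPrep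
open Summit.HodgeConjecture.HodgeConjecture.Cruxes.H413.K2E3GL3CuspidalBlockClosedCell

namespace Summit.HodgeConjecture.HodgeConjecture.Cruxes.H413.K2E3GL3CuspidalBlockJacquetCross

variable {F : Type*} [Field F] [ValuativeRel F] [TopologicalSpace F] [IsNonarchimedeanLocalField F]

/-! ## §1  The bridge `restrictUnipotentGL F ![0,1,1] I` ∕ `I ∘ N'.subtype` -/

section Bridge

variable {V : Type*} [AddCommGroup V] [Module ℂ V] (π : Representation ℂ (GL (Fin 3) F) V)

omit [ValuativeRel F] [TopologicalSpace F] [IsNonarchimedeanLocalField F] in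
/-- **The two presentations of `V(U_{P₍₁,₂₎})` agree**: the coinvariant kernel of `restrictUnipotentGL F ![0,1,1] π` (generators `π u v − v`, `u` in the kernel of the Levi projection of
`P₍₁,₂₎`) equals that of `π ∘ N'.subtype` (generators indexed by `N' = oppositeCellRadical ![0,0,1]`), because the two subgroups of `GL₃(F)` coincide (★ K0). [cite: BernsteinZelevinsky1977, §1.8 and §2.3] -/
theorem coinvariantsKer_restrictUnipotentGL_oneTwo_eq :
    Representation.Coinvariants.ker (Representation.restrictUnipotentGL F (![0, 1, 1] : Fin 3 → Fin 2) π) =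
      Representation.Coinvariants.ker (π.comp (oppositeCellRadical (K := F) (![0, 0, 1] : Fin 3 → Fin 2)).subtype) := by
  apply le_antisymm
  · refine Submodule.span_le.2 ?_
    rintro _ ⟨⟨u, v⟩, rfl⟩
    have hg : ((u : ↥(standardParabolicGL F (![0, 1, 1] : Fin 3 → Fin 2))) : GL (Fin 3) F) ∈ oppositeCellRadical (K := F) (![0, 0, 1] : Fin 3 → Fin 2) := by
      rw [oppositeCellRadical_eq_unipotentRadicalGL_oneTwo]
      exact ⟨u, u.2, rfl⟩
    exact Representation.Coinvariants.mem_ker_of_eq (ρ := π.comp (oppositeCellRadical (K := F) (![0, 0, 1] : Fin 3 → Fin 2)).subtype) ⟨_, hg⟩ v _ rfl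
  · refine Submodule.span_le.2 ?_
    rintro _ ⟨⟨n, v⟩, rfl⟩
    have hn : (n : GL (Fin 3) F) ∈ unipotentRadicalGL F (![0, 1, 1] : Fin 3 → Fin 2) := by
      rw [← oppositeCellRadical_eq_unipotentRadicalGL_oneTwo]
      exact n.2
    obtain ⟨u, hu, hun⟩ := hn
    refine Representation.Coinvariants.mem_ker_of_eq (ρ := Representation.restrictUnipotentGL F (![0, 1, 1] : Fin 3 → Fin 2) π) ⟨u, hu⟩ v _ ?_
    change π ((u : ↥(standardParabolicGL F (![0, 1, 1] : Fin 3 → Fin 2))) : GL (Fin 3) F) v - v = π (n : GL (Fin 3) F) v - v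
    rw [← hun]
    rfl

omit [ValuativeRel F] [TopologicalSpace F] [IsNonarchimedeanLocalField F] in
/-- **The carriers agree**: a linear equivalence `(restrictUnipotentGL F ![0,1,1] π).Coinvariants ≃ (π ∘ N'.subtype).Coinvariants` sending `[v]_{Q'} ↦ [v]` (Mathlib `Submodule.quotEquivOfEq`). [cite: BernsteinZelevinsky1977, §1.8 and §2.3] -/
theorem exists_coinvariants_linearEquiv :
    ∃ e : (Representation.restrictUnipotentGL F (![0, 1, 1] : Fin 3 → Fin 2) π).Coinvariants ≃ₗ[ℂ]
        Representation.Coinvariants (π.comp (oppositeCellRadical (K := F) (![0, 0, 1] : Fin 3 → Fin 2)).subtype),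
      ∀ v : V, e (Representation.Coinvariants.mk _ v) = Representation.Coinvariants.mk _ v :=
  ⟨Submodule.quotEquivOfEq _ _ (coinvariantsKer_restrictUnipotentGL_oneTwo_eq π), fun _ => rfl⟩

omit [ValuativeRel F] [TopologicalSpace F] [IsNonarchimedeanLocalField F] in
/-- **`w₀ M' w₀⁻¹ ≤ P`**: conjugation by `w₀ = permGL Fin.revPerm` carries the Levi `M' = standardLeviGL F ![0,1,1]` (blocks `{0} < {1,2}`) into `P = P₍₂,₁₎` (indeed onto its Levi `M`):
`(w₀ m w₀⁻¹)_{ab} = m_{rev a, rev b}`, so the entries `(2,0)`, `(2,1)` of the conjugate are `m_{02} = m_{01} = 0`. [cite: BernsteinZelevinsky1977, §2.1] -/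
theorem permGL_rev_conj_mem_standardParabolicGL_of_mem_standardLeviGL {m : GL (Fin 3) F}
    (hm : m ∈ standardLeviGL F (![0, 1, 1] : Fin 3 → Fin 2)) :
    permGL Fin.revPerm * m * (permGL Fin.revPerm)⁻¹ ∈ standardParabolicGL F (![0, 0, 1] : Fin 3 → Fin 2) := by
  rw [mem_standardLeviGL_iff] at hm
  rw [mem_standardParabolicGL_iff_entry, coe_permGL_mul_mul_inv, Matrix.submatrix_apply, Matrix.submatrix_apply]
  exact ⟨hm _ _ (by decide), hm _ _ (by decide)⟩

omit [ValuativeRel F] [TopologicalSpace F] [IsNonarchimedeanLocalField F] in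
/-- `M' ≤ P' = standardParabolicGL F (toDual ∘ revLabel ![0,0,1])` (★ K0 `reversedParabolic_eq_oneTwo`). [cite: BernsteinZelevinsky1977, §2.1] -/
theorem mem_reversedParabolic_of_mem_standardLeviGL {m : GL (Fin 3) F} (hm : m ∈ standardLeviGL F (![0, 1, 1] : Fin 3 → Fin 2)) :
    m ∈ standardParabolicGL F (⇑toDual ∘ revLabel (![0, 0, 1] : Fin 3 → Fin 2)) := by
  rw [reversedParabolic_eq_oneTwo]
  exact standardLeviGL_le F _ hm

omit [ValuativeRel F] [TopologicalSpace F] [IsNonarchimedeanLocalField F] in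
/-- `blockDiagonalGL F ![0,1,1] m ∈ M'` (it is `leviEmbedding F ![0,1,1] m`). [cite: BernsteinZelevinsky1977, §2.1] -/
theorem blockDiagonalGL_mem_standardLeviGL (m : Π a, GL {i // (![0, 1, 1] : Fin 3 → Fin 2) i = a} F) :
    blockDiagonalGL F (![0, 1, 1] : Fin 3 → Fin 2) m ∈ standardLeviGL F (![0, 1, 1] : Fin 3 → Fin 2) :=
  ⟨m, leviEmbedding_apply (![0, 1, 1] : Fin 3 → Fin 2) m⟩

end Bridge

/-! ## §2  The four lemmas of the lead's plan, in `[·]_{Q'}` currency -/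

section Heads

variable {W : Type*} [AddCommGroup W] [Module ℂ W] (σ' : Representation ℂ ↥(standardParabolicGL F (![0, 0, 1] : Fin 3 → Fin 2)) W)

/-- **(closed) every class of `r_{Q'}(I)` comes from the open cell**: for `σ'` smooth with `W(x₀₁) = W`, every `f ∈ I = Ind_P^{GL₃} σ'` has `[f]_{Q'} = [f₀]_{Q'}` for some `f₀` vanishing on
`{g₂₀ = 0}` (★ file 2b through the bridge). [cite: BernsteinZelevinsky1977, Lemma 2.12 and Thm. 5.2] [cite: Casselman1995, §6.3] -/
theorem exists_mem_vanishingOn_mk_eq (hσ' : σ'.IsSmooth)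
    (hW₀₁ : ∀ w : W, w ∈ Submodule.span ℂ {x : W | ∃ (a : F) (v : W),
      x = σ' ⟨transvectionUnit 0 1 (by decide) a, transvectionUnit_zero_one_mem_standardParabolicGL a⟩ v - v})
    (f : Representation.SmoothInd (standardParabolicGL F (![0, 0, 1] : Fin 3 → Fin 2)) σ') :
    ∃ f₀ ∈ vanishingOn (standardParabolicGL F (![0, 0, 1] : Fin 3 → Fin 2)) σ' (cellLT (K := F) (![0, 0, 1] : Fin 3 → Fin 2) Fin.revPerm),
      Representation.Coinvariants.mk (Representation.restrictUnipotentGL F (![0, 1, 1] : Fin 3 → Fin 2)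
          (Representation.smoothIndRep (standardParabolicGL F (![0, 0, 1] : Fin 3 → Fin 2)) σ')) f =
        Representation.Coinvariants.mk (Representation.restrictUnipotentGL F (![0, 1, 1] : Fin 3 → Fin 2)
          (Representation.smoothIndRep (standardParabolicGL F (![0, 0, 1] : Fin 3 → Fin 2)) σ')) f₀ := by
  obtain ⟨e, he⟩ := exists_coinvariants_linearEquiv (Representation.smoothIndRep (standardParabolicGL F (![0, 0, 1] : Fin 3 → Fin 2)) σ')
  obtain ⟨f₀, hf₀, h⟩ := exists_mem_vanishingOn_mk_comp_eq_of_span σ' hσ' hW₀₁ f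
  exact ⟨f₀, hf₀, e.injective (by rw [he, he, h])⟩

/-- **(open) every class of the open-cell part is a standard class** `[Φ_{K₀,w}]_{Q'}` (★ file 1 through the bridge). [cite: BernsteinZelevinsky1977, Lemma 2.12 and §5 (5.2)] -/
theorem exists_eq_mk_cellSection (hσ' : σ'.IsSmooth)
    (K₀ : Subgroup ↥(oppositeCellRadical (K := F) (![0, 0, 1] : Fin 3 → Fin 2)))
    (hK₀o : IsOpen (K₀ : Set ↥(oppositeCellRadical (K := F) (![0, 0, 1] : Fin 3 → Fin 2))))
    (hK₀c : IsCompact (K₀ : Set ↥(oppositeCellRadical (K := F) (![0, 0, 1] : Fin 3 → Fin 2))))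
    (f : Representation.SmoothInd (standardParabolicGL F (![0, 0, 1] : Fin 3 → Fin 2)) σ')
    (hf : f ∈ vanishingOn (standardParabolicGL F (![0, 0, 1] : Fin 3 → Fin 2)) σ' (cellLT (K := F) (![0, 0, 1] : Fin 3 → Fin 2) Fin.revPerm)) :
    ∃ w : W,
      Representation.Coinvariants.mk (Representation.restrictUnipotentGL F (![0, 1, 1] : Fin 3 → Fin 2)
          (Representation.smoothIndRep (standardParabolicGL F (![0, 0, 1] : Fin 3 → Fin 2)) σ')) f =
        Representation.Coinvariants.mk (Representation.restrictUnipotentGL F (![0, 1, 1] : Fin 3 → Fin 2)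
          (Representation.smoothIndRep (standardParabolicGL F (![0, 0, 1] : Fin 3 → Fin 2)) σ'))
          (cellSection σ' monotone_twoOne hσ' K₀ hK₀o hK₀c w) := by
  obtain ⟨e, he⟩ := exists_coinvariants_linearEquiv (Representation.smoothIndRep (standardParabolicGL F (![0, 0, 1] : Fin 3 → Fin 2)) σ')
  obtain ⟨w, h⟩ := K2E3OpenCellJacquetClasses.exists_eq_mk_cellSection monotone_twoOne hσ' K₀ hK₀o hK₀c f hf
  exact ⟨w, e.injective (by rw [he, he, h])⟩

/-- **Every class of `r_{Q'}(I)` is a standard class `[Φ_{K₀,w}]_{Q'}`** (closed + open): `w ↦ [Φ_{K₀,w}]_{Q'}` is a surjection `W ↠ r_{Q'}(I)`. [cite: BernsteinZelevinsky1977, Lemma 2.12 and Thm. 5.2] -/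
theorem exists_eq_mk_cellSection_of_span (hσ' : σ'.IsSmooth)
    (hW₀₁ : ∀ w : W, w ∈ Submodule.span ℂ {x : W | ∃ (a : F) (v : W),
      x = σ' ⟨transvectionUnit 0 1 (by decide) a, transvectionUnit_zero_one_mem_standardParabolicGL a⟩ v - v})
    (K₀ : Subgroup ↥(oppositeCellRadical (K := F) (![0, 0, 1] : Fin 3 → Fin 2)))
    (hK₀o : IsOpen (K₀ : Set ↥(oppositeCellRadical (K := F) (![0, 0, 1] : Fin 3 → Fin 2))))
    (hK₀c : IsCompact (K₀ : Set ↥(oppositeCellRadical (K := F) (![0, 0, 1] : Fin 3 → Fin 2))))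
    (x : (Representation.restrictUnipotentGL F (![0, 1, 1] : Fin 3 → Fin 2)
      (Representation.smoothIndRep (standardParabolicGL F (![0, 0, 1] : Fin 3 → Fin 2)) σ')).Coinvariants) :
    ∃ w : W, x = Representation.Coinvariants.mk (Representation.restrictUnipotentGL F (![0, 1, 1] : Fin 3 → Fin 2)
          (Representation.smoothIndRep (standardParabolicGL F (![0, 0, 1] : Fin 3 → Fin 2)) σ'))
          (cellSection σ' monotone_twoOne hσ' K₀ hK₀o hK₀c w) := by
  obtain ⟨f, rfl⟩ := Representation.Coinvariants.mk_surjective _ x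
  obtain ⟨f₀, hf₀, h⟩ := exists_mem_vanishingOn_mk_eq σ' hσ' hW₀₁ f
  obtain ⟨w, hw⟩ := exists_eq_mk_cellSection σ' hσ' K₀ hK₀o hK₀c f₀ hf₀
  exact ⟨w, h.trans hw⟩

/-- **The Levi `M'` acts on standard classes through `σ' ∘ Ad(w₀)`, up to positive rationals**: for `m' ∈ M' = standardLeviGL F ![0,1,1]` there is `q ∈ ℚ_{>0}` with
`[m' · Φ_{K₀,w}]_{Q'} = q • [Φ_{K₀, σ'(w₀ m' w₀⁻¹) w}]_{Q'}` for all `w` (★ file 1 through the bridge). [cite: BernsteinZelevinsky1977, Lemma 2.12 and §5 (5.2)] -/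
theorem mk_cellSection_levi' (hσ' : σ'.IsSmooth)
    (K₀ : Subgroup ↥(oppositeCellRadical (K := F) (![0, 0, 1] : Fin 3 → Fin 2)))
    (hK₀o : IsOpen (K₀ : Set ↥(oppositeCellRadical (K := F) (![0, 0, 1] : Fin 3 → Fin 2))))
    (hK₀c : IsCompact (K₀ : Set ↥(oppositeCellRadical (K := F) (![0, 0, 1] : Fin 3 → Fin 2))))
    {m' : GL (Fin 3) F} (hm' : m' ∈ standardLeviGL F (![0, 1, 1] : Fin 3 → Fin 2)) :
    ∃ q : ℚ, 0 < q ∧ ∀ w : W,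
      Representation.Coinvariants.mk (Representation.restrictUnipotentGL F (![0, 1, 1] : Fin 3 → Fin 2)
          (Representation.smoothIndRep (standardParabolicGL F (![0, 0, 1] : Fin 3 → Fin 2)) σ'))
          (Representation.smoothIndRep (standardParabolicGL F (![0, 0, 1] : Fin 3 → Fin 2)) σ' m' (cellSection σ' monotone_twoOne hσ' K₀ hK₀o hK₀c w)) =
        (q : ℂ) • Representation.Coinvariants.mk (Representation.restrictUnipotentGL F (![0, 1, 1] : Fin 3 → Fin 2)
          (Representation.smoothIndRep (standardParabolicGL F (![0, 0, 1] : Fin 3 → Fin 2)) σ'))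
          (cellSection σ' monotone_twoOne hσ' K₀ hK₀o hK₀c
            (σ' ⟨permGL Fin.revPerm * m' * (permGL Fin.revPerm)⁻¹, permGL_rev_conj_mem_standardParabolicGL_of_mem_standardLeviGL hm'⟩ w)) := by
  obtain ⟨e, he⟩ := exists_coinvariants_linearEquiv (Representation.smoothIndRep (standardParabolicGL F (![0, 0, 1] : Fin 3 → Fin 2)) σ')
  obtain ⟨q, hq, h⟩ := K2E3OpenCellJacquetClasses.exists_mk_smoothIndRep_cellSection_eq_smul monotone_twoOne hσ' K₀ hK₀o hK₀c
    (mem_reversedParabolic_of_mem_standardLeviGL hm') (permGL_rev_conj_mem_standardParabolicGL_of_mem_standardLeviGL hm')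
  exact ⟨q, hq, fun w => e.injective (by rw [map_smul, he, he, h w])⟩

/-- **The standard classes are non-zero**: `w ≠ 0 ⇒ [Φ_{K₀,w}]_{Q'} ≠ 0` (★ file 1 through the bridge). [cite: BernsteinZelevinsky1977, §5 (5.2) and Prop. 1.9 (a)] [cite: Casselman1995, §6.3] -/
theorem mk_cellSection_ne_zero (hσ' : σ'.IsSmooth)
    (K₀ : Subgroup ↥(oppositeCellRadical (K := F) (![0, 0, 1] : Fin 3 → Fin 2)))
    (hK₀o : IsOpen (K₀ : Set ↥(oppositeCellRadical (K := F) (![0, 0, 1] : Fin 3 → Fin 2))))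
    (hK₀c : IsCompact (K₀ : Set ↥(oppositeCellRadical (K := F) (![0, 0, 1] : Fin 3 → Fin 2)))) {w : W} (hw : w ≠ 0) :
    Representation.Coinvariants.mk (Representation.restrictUnipotentGL F (![0, 1, 1] : Fin 3 → Fin 2)
        (Representation.smoothIndRep (standardParabolicGL F (![0, 0, 1] : Fin 3 → Fin 2)) σ'))
        (cellSection σ' monotone_twoOne hσ' K₀ hK₀o hK₀c w) ≠ 0 := by
  obtain ⟨e, he⟩ := exists_coinvariants_linearEquiv (Representation.smoothIndRep (standardParabolicGL F (![0, 0, 1] : Fin 3 → Fin 2)) σ')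
  intro h
  have h' := congrArg e h
  rw [he, map_zero] at h'
  exact K2E3OpenCellJacquetClasses.mk_cellSection_ne_zero monotone_twoOne hσ' K₀ hK₀o hK₀c hw h'

end Heads

/-! ## §3  `r_{P₍₁,₂₎}(Ind_{P₍₂,₁₎}^{GL₃} σ')` is irreducible -/

section Irreducible

variable {W : Type*} [AddCommGroup W] [Module ℂ W]

/-- **JM-B, THE CROSS JACQUET MODULE IS IRREDUCIBLE — `hirr` over the subgroup `M' = standardLeviGL F ![0,1,1]`** (letters of ★ BLK sequel
`forall_submodule_eq_bot_or_top_of_leviStable_rev'`; the block-diagonal letters of the lead's SPEC are `isIrreducible_jacquetGL_oneTwo` below).  Let `σ'` be a smooth representation of `P = P₍₂,₁₎ ≤ GL₃(F)` on `W ≠ 0` with `W(x₀₁) = W` (`hW₀₁`: every vector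
lies in the span of the `σ'(x₀₁ a) v − v` — the `GL₂`-block is cuspidal) and such that `W` has no proper non-zero `ℂ`-submodule stable under `σ'(w₀ m w₀⁻¹)`, `m ∈ M' = standardLeviGL F ![0,1,1]`
(`hirr`: `σ'|_{M}` is irreducible).  Then the Jacquet module `jacquetGL F ![0,1,1] (Ind_P^{GL₃} σ')` along `U_{P₍₁,₂₎}` is an IRREDUCIBLE representation of the block Levi.
Proof: `w ↦ [Φ_{K₀,w}]_{Q'}` is a linear surjection `W ↠ r_{Q'}(I)` (§2: closed orbit invisible + open orbit standard); the preimage `Y` of a subrepresentation `Y'` is a submodule stable under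
`σ' ∘ Ad(w₀)|_{M'}` (for `m ∈ M'`, `[Φ_{K₀, σ'(w₀ m w₀⁻¹) y}]_{Q'} = q⁻¹ • (diag-action of `m`) [Φ_{K₀,y}]_{Q'} ∈ Y'`, ★ `jacquetGL_mk`), so `Y = ⊥` (then `Y' = ⊥`) or `Y = ⊤` (then `Y' = ⊤`);
and `r_{Q'}(I) ≠ 0` since `[Φ_{K₀,w}]_{Q'} ≠ 0` for `w ≠ 0`. [cite: BernsteinZelevinsky1977, Lemma 2.12 and Thm. 5.2] [cite: Zelevinsky1980, §1.1–1.2] [cite: Casselman1995, §6.3] -/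
theorem isIrreducible_jacquetGL_oneTwo' (σ' : Representation ℂ ↥(standardParabolicGL F (![0, 0, 1] : Fin 3 → Fin 2)) W) (hσ' : σ'.IsSmooth) [Nontrivial W]
    (hW₀₁ : ∀ w : W, w ∈ Submodule.span ℂ {x : W | ∃ (a : F) (v : W),
      x = σ' ⟨transvectionUnit 0 1 (by decide) a, transvectionUnit_zero_one_mem_standardParabolicGL a⟩ v - v})
    (hirr : ∀ Y : Submodule ℂ W,
      (∀ (m : GL (Fin 3) F) (hm : m ∈ standardLeviGL F (![0, 1, 1] : Fin 3 → Fin 2)) (y : W), y ∈ Y →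
        σ' ⟨permGL Fin.revPerm * m * (permGL Fin.revPerm)⁻¹, permGL_rev_conj_mem_standardParabolicGL_of_mem_standardLeviGL hm⟩ y ∈ Y) →
      Y = ⊥ ∨ Y = ⊤) :
    (Representation.jacquetGL F (![0, 1, 1] : Fin 3 → Fin 2)
      (Representation.smoothIndRep (standardParabolicGL F (![0, 0, 1] : Fin 3 → Fin 2)) σ')).IsIrreducible := by
  classical
  -- a compact open subgroup `K₀ ≤ N'`
  have hlim : IsLimitOfCompactOpen ↥(oppositeCellRadical (K := F) (![0, 0, 1] : Fin 3 → Fin 2)) :=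
    isLimitOfCompactOpen_unipotentRadicalGL F (⇑toDual ∘ revLabel (![0, 0, 1] : Fin 3 → Fin 2)) (monotone_toDual_revLabel _ monotone_twoOne)
  obtain ⟨K₀, hK₀o, hK₀c, -⟩ := hlim ∅ isCompact_empty
  -- the linear map `w ↦ [Φ_{K₀,w}]_{Q'}`
  let Φ : W →ₗ[ℂ] (Representation.restrictUnipotentGL F (![0, 1, 1] : Fin 3 → Fin 2)
      (Representation.smoothIndRep (standardParabolicGL F (![0, 0, 1] : Fin 3 → Fin 2)) σ')).Coinvariants :=
    (Representation.Coinvariants.mk _) ∘ₗ (cellSectionₗ σ' monotone_twoOne hσ' K₀ hK₀o hK₀c)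
  have hΦ : ∀ w, Φ w = Representation.Coinvariants.mk (Representation.restrictUnipotentGL F (![0, 1, 1] : Fin 3 → Fin 2)
      (Representation.smoothIndRep (standardParabolicGL F (![0, 0, 1] : Fin 3 → Fin 2)) σ')) (cellSection σ' monotone_twoOne hσ' K₀ hK₀o hK₀c w) :=
    fun w => rfl
  have hsurj : ∀ x, ∃ w, x = Φ w := fun x => exists_eq_mk_cellSection_of_span σ' hσ' hW₀₁ K₀ hK₀o hK₀c x
  -- non-triviality of the lattice of subrepresentations
  obtain ⟨w₁, hw₁⟩ := exists_ne (0 : W)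
  have hne : Φ w₁ ≠ 0 := mk_cellSection_ne_zero σ' hσ' K₀ hK₀o hK₀c hw₁
  haveI : Nontrivial (Subrepresentation (Representation.jacquetGL F (![0, 1, 1] : Fin 3 → Fin 2)
      (Representation.smoothIndRep (standardParabolicGL F (![0, 0, 1] : Fin 3 → Fin 2)) σ'))) := by
    refine ⟨⟨⊥, ⊤, fun h => hne ?_⟩⟩
    have hmem : Φ w₁ ∈ (⊤ : Subrepresentation (Representation.jacquetGL F (![0, 1, 1] : Fin 3 → Fin 2)
        (Representation.smoothIndRep (standardParabolicGL F (![0, 0, 1] : Fin 3 → Fin 2)) σ'))).toSubmodule := Submodule.mem_top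
    rw [← h] at hmem
    exact (Submodule.mem_bot ℂ).1 hmem
  refine ⟨fun Y' => ?_⟩
  -- the preimage submodule and its stability
  let Y : Submodule ℂ W := Y'.toSubmodule.comap Φ
  have hY : ∀ (m : GL (Fin 3) F) (hm : m ∈ standardLeviGL F (![0, 1, 1] : Fin 3 → Fin 2)) (y : W), y ∈ Y →
      σ' ⟨permGL Fin.revPerm * m * (permGL Fin.revPerm)⁻¹, permGL_rev_conj_mem_standardParabolicGL_of_mem_standardLeviGL hm⟩ y ∈ Y := by
    intro m hm y hy
    obtain ⟨q, hq, hlev⟩ := mk_cellSection_levi' σ' hσ' K₀ hK₀o hK₀c hm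
    obtain ⟨mm, hmm⟩ := hm
    change Φ _ ∈ Y'.toSubmodule
    have hy' : Φ y ∈ Y'.toSubmodule := hy
    -- `[m · Φ_{K₀,y}] = (diag action of mm) [Φ_{K₀,y}] ∈ Y'`
    have hact : Representation.Coinvariants.mk (Representation.restrictUnipotentGL F (![0, 1, 1] : Fin 3 → Fin 2)
        (Representation.smoothIndRep (standardParabolicGL F (![0, 0, 1] : Fin 3 → Fin 2)) σ'))
        (Representation.smoothIndRep (standardParabolicGL F (![0, 0, 1] : Fin 3 → Fin 2)) σ' m (cellSection σ' monotone_twoOne hσ' K₀ hK₀o hK₀c y)) ∈ Y'.toSubmodule := by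
      have h := Y'.apply_mem_toSubmodule mm hy'
      rw [hΦ, Representation.jacquetGL_mk, ← leviEmbedding_apply, hmm] at h
      exact h
    rw [hlev y] at hact
    have h2 := Y'.toSubmodule.smul_mem ((q : ℂ)⁻¹) hact
    rwa [smul_smul, inv_mul_cancel₀ (by exact_mod_cast hq.ne'), one_smul, ← hΦ] at h2
  rcases hirr Y hY with hbot | htop
  · -- `Y = ⊥ ⇒ Y' = ⊥`
    left
    apply Subrepresentation.toSubmodule_injective
    refine (Submodule.eq_bot_iff _).2 fun x hx => ?_
    obtain ⟨w, rfl⟩ := hsurj x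
    have hw : w ∈ Y := hx
    rw [hbot, Submodule.mem_bot] at hw
    rw [hw, map_zero]
  · -- `Y = ⊤ ⇒ Y' = ⊤`
    right
    apply Subrepresentation.toSubmodule_injective
    refine Submodule.eq_top_iff'.2 fun x => ?_
    obtain ⟨w, rfl⟩ := hsurj x
    have hw : w ∈ Y := by rw [htop]; exact Submodule.mem_top
    exact hw

/-- **JM-B, THE CROSS JACQUET MODULE IS IRREDUCIBLE** (lead K2E3-p24 (g2) SPEC 10:27:03Z ∕ 10:42:24Z, `hirr` in the block-diagonal letters of ★ BLK `forall_submodule_eq_bot_or_top_of_leviStable_rev`, membership proof = ★ BLK `permGL_rev_conj_blockDiagonalGL_mem F m` VERBATIM).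
For `σ'` a smooth representation of `P = P₍₂,₁₎ ≤ GL₃(F)` on `W ≠ 0` with `W(x₀₁) = W` (`hW₀₁` = ★ BLK `mem_span_twist_transvection_zero_one_sub` for `σ' = σ ∘ proj ⊗ δ^{1∕2}`, `σ` cuspidal on the
`GL₂` block) and no proper non-zero submodule stable under the `σ'(w₀ · diag(m) · w₀⁻¹)`, `m : Π a, GL {i ∕∕ ![0,1,1] i = a} F` (`hirr` = ★ BLK `…_leviStable_rev`): the Jacquet module
`jacquetGL F ![0,1,1] (Ind_P^{GL₃} σ')` along `U_{P₍₁,₂₎}` is IRREDUCIBLE (the cross term `w₀ ∘ σ'|_M` of the Geometrical Lemma; the closed orbit contributes nothing).  Reduction to the subgroup form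
`isIrreducible_jacquetGL_oneTwo'`: `diag(m) ∈ M'`. [cite: BernsteinZelevinsky1977, Lemma 2.12 and Thm. 5.2] [cite: Zelevinsky1980, §1.1–1.2] [cite: Casselman1995, §6.3] -/
theorem isIrreducible_jacquetGL_oneTwo (σ' : Representation ℂ ↥(standardParabolicGL F (![0, 0, 1] : Fin 3 → Fin 2)) W) (hσ' : σ'.IsSmooth) [Nontrivial W]
    (hW₀₁ : ∀ w : W, w ∈ Submodule.span ℂ {x : W | ∃ (a : F) (v : W),
      x = σ' ⟨transvectionUnit 0 1 (by decide) a, transvectionUnit_zero_one_mem_standardParabolicGL a⟩ v - v})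
    (hirr : ∀ Y : Submodule ℂ W,
      (∀ (m : Π a, GL {i // (![0, 1, 1] : Fin 3 → Fin 2) i = a} F) (y : W), y ∈ Y →
        σ' ⟨(permGL Fin.revPerm : GL (Fin 3) F) * blockDiagonalGL F (![0, 1, 1] : Fin 3 → Fin 2) m * (permGL Fin.revPerm)⁻¹,
          K2E3GL3CuspidalBlockRestriction.permGL_rev_conj_blockDiagonalGL_mem F m⟩ y ∈ Y) →
      Y = ⊥ ∨ Y = ⊤) :
    (Representation.jacquetGL F (![0, 1, 1] : Fin 3 → Fin 2)
      (Representation.smoothIndRep (standardParabolicGL F (![0, 0, 1] : Fin 3 → Fin 2)) σ')).IsIrreducible :=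
  isIrreducible_jacquetGL_oneTwo' σ' hσ' hW₀₁ fun Y hY =>
    hirr Y fun m y hy => hY (blockDiagonalGL F (![0, 1, 1] : Fin 3 → Fin 2) m) (blockDiagonalGL_mem_standardLeviGL m) y hy

end Irreducible

end Summit.HodgeConjecture.HodgeConjecture.Cruxes.H413.K2E3GL3CuspidalBlockJacquetCross

end
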